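import Literature.AlgebraicGeometry.Motives.AbelianVarietyInducedActionMackey
import HarnessLib

/-!
# The integral endomorphism rank of an induced action for a normal subgroup (Serre §7.4 Prop. 23 and Cor.):
# `rk_ℤ End_G(Ind_H^G Y) = Σ_{u ∈ G/H} rk_ℤ Hom_H(α, ρ^u)` and `|H| · rk_ℤ End_G(Ind_H^G Y) = Σ_{x ∈ G} rk_ℤ Hom_H(α, α^x)`

`X = ⊕_{t ∈ T} Y_t = Ind_H^G (Y, α)` is an induced action on a power of an abelian variety over a field `K` (bicone `b`,
`Σ_t π_t ≫ ι_t = 𝟙`; `ρ : G → End X` with `ι_t ρ(g) π_u = 0` for `u ≠ g t`; `T` transitive, `H = Stab(t₀)`,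
`α(h) = ι_{t₀} ρ(h) π_{t₀}`).  `Motives/AbelianVarietyInducedActionReciprocity` proved Frobenius reciprocity at the level of
the groups of equivariant homomorphisms, `rk_ℤ End_G(Ind Y) = rk_ℤ Hom_H((Y, α), Res_H Ind Y)`, and
`Motives/AbelianVarietyInducedActionIntertwining` the `ℓ`-ADIC form of Mackey's `⟨V, V⟩_G = Σ_{s ∈ H\G/H} d_s` (which only
bounds the integral rank).  For a NORMAL `H` the Mackey decomposition `Res_H Ind_H^G W = ⊕_{s ∈ G/H} W_s` is summand by
summand, and this file proves the INTEGRAL form (theorems only, no definition):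

* §1 for a subgroup `L ≤ G` fixing every index (`l u = u`) and any `L`-action `β` on `Y`:
  **`rk_ℤ Hom_L((Y, β), Res_L X') = Σ_{u ∈ T'} rk_ℤ Hom_L((Y, β), (Y'_u, ι_u ρ'(·) π_u))`** (an explicit additive bijection
  `f ↦ (f ≫ π_u)_u` between the groups of equivariant maps);
* §2 for `H = Stab(t₀)` normal: **`rk_ℤ End_G(Ind_H^G Y) = Σ_{u ∈ T} rk_ℤ Hom_H(α, ι_u ρ(·) π_u)`**, the identification of the
  block action at `x t₀` with the conjugate `α^x = α ∘ conj(x⁻¹)` on equivariant maps (`rk Hom_H(α, ι_{xt₀} ρ π_{xt₀}) = rk Hom_H(α, α^x)`,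
  by the transfer isomorphism `φ_{x,t₀}`), and for `G` finite
  **`|H| · rk_ℤ End_G(Ind_H^G Y) = Σ_{x ∈ G} rk_ℤ Hom_H(α, α^x)`** — Serre's `⟨V, V⟩_G = Σ_{s ∈ G/H} ⟨ρ, ρ^s⟩_H`;
* §3 `rk Hom_H(α, α^x) = rk End_H(α)` for `x ∈ H`, hence
  **`|H| · rk_ℤ End_G(Ind_H^G Y) = |H| · rk_ℤ End_H(Y, α) + Σ_{x ∉ H} rk_ℤ Hom_H(α, α^x)`** and `rk End_H(α) ≤ rk End_G(Ind Y)` —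
  the normal case of Mackey's irreducibility criterion ("`Ind ρ` irreducible iff `ρ` irreducible and `ρ ≇ ρ^s` for `s ∉ H`")
  for the endomorphism ranks of abelian varieties.

## References

* [SerreLinearRepresentations1977] J.-P. Serre, *Linear Representations of Finite Groups*, GTM 42 (1977): §7.3 Prop. 22, §7.4
  Prop. 23 and Corollary ("we have then `H_s = H` and `Res_s(ρ) = ρ`").  Held:
  `book:serre1977-linear-representations-finite-groups`, PDF pp. 53–54 read 2026-08-28.
* [MumfordAV1970] D. Mumford, *Abelian Varieties* (1970), §19 (p. 173: homomorphisms of products), Thm. 3 (p. 176: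
  `Hom(X, Y)` is a finitely generated free abelian group).
-/

noncomputable section

open CategoryTheory CategoryTheory.Limits MulAction
open Literature.NumberTheory.DiophantineGeometry

universe u

namespace Literature.AlgebraicGeometry.Motives

namespace AbelianVariety

namespace Imprimitive

variable {K : Type u} [Field K]

/-! ## §1 Maps into an imprimitive system for a subgroup acting trivially on the index set -/

section TrivialOnIndex

variable {Y Y' : AbelianVariety K} {T' : Type} [Fintype T'] (b' : Bicone (fun _ : T' ↦ Y'))
  {G : Type} [Group G] [MulAction G T'] (ρ' : G →* End b'.pt) (L : Subgroup G) (β : L →* End Y)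

/-- **`Hom_L((Y, β), Res_L X') ≅ ⊕_{u ∈ T'} Hom_L((Y, β), (Y'_u, ι_u ρ'(·) π_u))` when `L` fixes every index**: for an
imprimitive system `(b', ρ')` over `T'` and a subgroup `L ≤ G` with `l u = u` for all `l ∈ L`, `u ∈ T'` (e.g. `L = H'` NORMAL,
`T' = G/H'`), every summand `Y'_u` is `L`-stable with action `l ↦ ι_u ρ'(l) π_u`, and an `L`-map `f : Y → X'` is the same as the
family of `L`-maps `f ≫ π_u : Y → Y'_u`; in particular
**`rk_ℤ Hom_L(Y, Res_L X') = Σ_{u ∈ T'} rk_ℤ Hom_L(Y, Y'_u)`** ("`Res_H V = ⊕_{s ∈ G/H} W_s`" for `H` normal).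
[cite: SerreLinearRepresentations1977, §7.3 Prop. 22 and §7.4 Cor. (`H_s = H`)] [cite: MumfordAV1970, §19 (p. 173)] -/
theorem finrank_equivariantHom_target_eq_sum_of_smul_eq (hb' : ∑ t, b'.π t ≫ b'.ι t = 𝟙 b'.pt)
    (hρ' : ∀ (g : G) (t u : T'), g • t ≠ u → b'.ι t ≫ End.asHom (ρ' g) ≫ b'.π u = 0)
    (htriv : ∀ (l : L) (u : T'), l • u = u) :
    Module.finrank ℤ (⨅ l : L, LinearMap.eqLocus (Preadditive.leftComp b'.pt (End.asHom (β l))).toIntLinearMap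
        (Preadditive.rightComp Y (End.asHom (ρ' l))).toIntLinearMap : Submodule ℤ (Y ⟶ b'.pt)) =
      ∑ u : T', Module.finrank ℤ (⨅ l : L,
        LinearMap.eqLocus (Preadditive.leftComp Y' (End.asHom (β l))).toIntLinearMap
          (Preadditive.rightComp Y (b'.ι u ≫ End.asHom (ρ' l) ≫ b'.π u)).toIntLinearMap : Submodule ℤ (Y ⟶ Y')) := by
  haveI : Module.Free ℤ (Y ⟶ Y') := module_free_hom_holds Y Y'
  haveI : Module.Finite ℤ (Y ⟶ Y') := module_finite_hom_holds Y Y'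
  set V := (⨅ l : L, LinearMap.eqLocus (Preadditive.leftComp b'.pt (End.asHom (β l))).toIntLinearMap
    (Preadditive.rightComp Y (End.asHom (ρ' l))).toIntLinearMap : Submodule ℤ (Y ⟶ b'.pt)) with hV
  let W : T' → Submodule ℤ (Y ⟶ Y') := fun u ↦ ⨅ l : L,
    LinearMap.eqLocus (Preadditive.leftComp Y' (End.asHom (β l))).toIntLinearMap
      (Preadditive.rightComp Y (b'.ι u ≫ End.asHom (ρ' l) ≫ b'.π u)).toIntLinearMap
  change Module.finrank ℤ V = ∑ u : T', Module.finrank ℤ (W u)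
  have memV : ∀ f : Y ⟶ b'.pt, f ∈ V ↔ ∀ l : L, End.asHom (β l) ≫ f = f ≫ End.asHom (ρ' l) := fun f ↦ by
    rw [hV]
    simp only [Submodule.mem_iInf, LinearMap.mem_eqLocus]
    exact Iff.rfl
  have memW : ∀ (u : T') (v : Y ⟶ Y'), v ∈ W u ↔
      ∀ l : L, End.asHom (β l) ≫ v = v ≫ (b'.ι u ≫ End.asHom (ρ' l) ≫ b'.π u) := fun u v ↦ by
    simp only [W, Submodule.mem_iInf, LinearMap.mem_eqLocus]
    exact Iff.rfl
  have crit : ∀ f : Y ⟶ b'.pt, (∀ l : L, End.asHom (β l) ≫ f = f ≫ End.asHom (ρ' l)) ↔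
      ∀ (l : L) (u : T'), End.asHom (β l) ≫ f ≫ b'.π u = (f ≫ b'.π u) ≫ (b'.ι u ≫ End.asHom (ρ' l) ≫ b'.π u) := by
    intro f
    have h := comm_iff_target b' (ρ'.comp L.subtype) β hb' (restrict b' ρ' hρ' L) f
    simp only [htriv, MonoidHom.comp_apply, Subgroup.coe_subtype] at h
    exact h
  haveI : Module.IsTorsionFree ℤ (Y ⟶ Y') := inferInstance
  haveI : ∀ u, Module.Finite ℤ (W u) := fun u ↦ Module.Finite.of_injective (W u).subtype (W u).injective_subtype
  haveI : ∀ u, Module.Free ℤ (W u) := fun u ↦ Module.free_of_finite_type_torsion_free'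
  let e : V ≃+ (Π u : T', W u) :=
    { toFun := fun f u ↦ ⟨(f : Y ⟶ b'.pt) ≫ b'.π u, (memW u _).2 fun l ↦ ((crit _).1 ((memV _).1 f.2)) l u⟩
      invFun := fun v ↦ ⟨∑ u, (v u : Y ⟶ Y') ≫ b'.ι u, (memV _).2 ((crit _).2 fun l u ↦ by
          rw [sum_comp_ι_comp_π b' (fun w ↦ (v w : Y ⟶ Y')) u]
          exact (memW u _).1 (v u).2 l)⟩
      left_inv := fun f ↦ Subtype.ext (eq_sum_comp_π_comp_ι b' hb' (f : Y ⟶ b'.pt)).symm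
      right_inv := fun v ↦ funext fun u ↦ Subtype.ext (sum_comp_ι_comp_π b' (fun w ↦ (v w : Y ⟶ Y')) u)
      map_add' := fun f f' ↦ funext fun u ↦ Subtype.ext (by
          change ((f : Y ⟶ b'.pt) + (f' : Y ⟶ b'.pt)) ≫ b'.π u = (f : Y ⟶ b'.pt) ≫ b'.π u + (f' : Y ⟶ b'.pt) ≫ b'.π u
          rw [Preadditive.add_comp]) }
  rw [e.toIntLinearEquiv.finrank_eq, Module.finrank_pi_fintype ℤ]

end TrivialOnIndex

/-! ## §2 `H` normal: `rk_ℤ End_G(Ind_H^G Y) = Σ_{u ∈ G/H} rk_ℤ Hom_H(α, ι_u ρ(·) π_u)` and the blocks are the conjugates `α^x` -/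

section Normal

variable {Y : AbelianVariety K} {T : Type} [Fintype T] (b : Bicone (fun _ : T ↦ Y))
  {G : Type} [Group G] [MulAction G T] [IsPretransitive G T] (ρ : G →* End b.pt) (t₀ : T)
  (α : stabilizer G t₀ →* End Y)

omit [Fintype T] in
/-- A normal stabiliser of a transitive action fixes every point (private helper). [folklore] -/
private theorem subgroup_smul_eq_of_normal [nH : (stabilizer G t₀).Normal] (h : stabilizer G t₀) (u : T) : h • u = u := by
  obtain ⟨x, rfl⟩ := exists_smul_eq G t₀ u
  have hm : x⁻¹ * h * x ∈ stabilizer G t₀ := by simpa using nH.conj_mem (h : G) h.2 x⁻¹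
  rw [Subgroup.smul_def, smul_smul]
  calc ((h : G) * x) • t₀ = (x * (x⁻¹ * h * x)) • t₀ := by rw [show x * (x⁻¹ * (h : G) * x) = h * x by group]
    _ = x • (x⁻¹ * h * x) • t₀ := mul_smul _ _ _
    _ = x • t₀ := by rw [mem_stabilizer_iff.1 hm]

/-- **`rk_ℤ End_G(Ind_H^G Y) = Σ_{u ∈ T} rk_ℤ Hom_H((Y, α), (Y_u, ι_u ρ(·) π_u))` for `H = Stab(t₀)` NORMAL** (any field, any `G`):
Frobenius reciprocity `End_G(Ind Y) ≅ Hom_H(Y, Res_H Ind Y)` (`Motives/AbelianVarietyInducedActionReciprocity`) and, `H` being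
normal and hence fixing every `u ∈ T`, `Res_H Ind_H^G Y = ⊕_{u ∈ T} (Y_u, ι_u ρ(·) π_u)` summand by summand (§1) —
"`Res_H V = ⊕_{s ∈ G/H} W_s`, `⟨V, V⟩_G = Σ_{s ∈ G/H} ⟨ρ, ρ^s⟩_H`". [cite: SerreLinearRepresentations1977, §7.4 Prop. 23 and Cor.]
[cite: MumfordAV1970, §19 Thm. 3 (p. 176)] -/
theorem finrank_equivariantEnd_eq_sum_of_normal [(stabilizer G t₀).Normal] (hb : ∑ t, b.π t ≫ b.ι t = 𝟙 b.pt)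
    (hρ : ∀ (g : G) (t u : T), g • t ≠ u → b.ι t ≫ End.asHom (ρ g) ≫ b.π u = 0)
    (hα : ∀ h : stabilizer G t₀, End.asHom (α h) = b.ι t₀ ≫ End.asHom (ρ h) ≫ b.π t₀) :
    Module.finrank ℤ (⨅ g : G, LinearMap.eqLocus (Preadditive.leftComp b.pt (End.asHom (ρ g))).toIntLinearMap
        (Preadditive.rightComp b.pt (End.asHom (ρ g))).toIntLinearMap : Submodule ℤ (b.pt ⟶ b.pt)) =
      ∑ u : T, Module.finrank ℤ (⨅ h : stabilizer G t₀,
        LinearMap.eqLocus (Preadditive.leftComp Y (End.asHom (α h))).toIntLinearMap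
          (Preadditive.rightComp Y (b.ι u ≫ End.asHom (ρ h) ≫ b.π u)).toIntLinearMap : Submodule ℤ (Y ⟶ Y)) := by
  rw [finrank_equivariantHom_source_eq b ρ ρ t₀ α hb hρ hα]
  exact finrank_equivariantHom_target_eq_sum_of_smul_eq b ρ (stabilizer G t₀) α hb hρ
    (subgroup_smul_eq_of_normal t₀)

omit [IsPretransitive G T] in
/-- **The block at `x t₀` is the conjugate action `α^x(h) = α(x⁻¹hx)`, on equivariant maps**: for `H = Stab(t₀)` normal,
`rk_ℤ Hom_H((Y, α), (Y_{xt₀}, ι_{xt₀} ρ(·) π_{xt₀})) = rk_ℤ Hom_H(α, α^x)` where `α^x = α ∘ conj(x⁻¹)` on `H`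
(`v ↦ v ≫ φ_{x⁻¹, xt₀}` and `w ↦ w ≫ φ_{x,t₀}` are inverse bijections, by `α(k) ≫ φ_{x,t₀} = φ_{x,t₀} ≫ (ι_{xt₀} ρ(xkx⁻¹) π_{xt₀})`,
`Motives/AbelianVarietyInducedActionMackey`) — "`sW` is `H_s`-isomorphic to `W_s`, `ρ^s(x) = ρ(s⁻¹xs)`".
[cite: SerreLinearRepresentations1977, §7.3 Prop. 22 (proof) and §7.4] -/
theorem finrank_equivariantHom_block_eq_finrank_conj [(stabilizer G t₀).Normal] (hb : ∑ t, b.π t ≫ b.ι t = 𝟙 b.pt)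
    (hρ : ∀ (g : G) (t u : T), g • t ≠ u → b.ι t ≫ End.asHom (ρ g) ≫ b.π u = 0)
    (hα : ∀ h : stabilizer G t₀, End.asHom (α h) = b.ι t₀ ≫ End.asHom (ρ h) ≫ b.π t₀) (x : G) :
    Module.finrank ℤ (⨅ h : stabilizer G t₀,
        LinearMap.eqLocus (Preadditive.leftComp Y (End.asHom (α h))).toIntLinearMap
          (Preadditive.rightComp Y (b.ι (x • t₀) ≫ End.asHom (ρ h) ≫ b.π (x • t₀))).toIntLinearMap : Submodule ℤ (Y ⟶ Y)) =
      Module.finrank ℤ (⨅ h : stabilizer G t₀,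
        LinearMap.eqLocus (Preadditive.leftComp Y (End.asHom (α h))).toIntLinearMap
          (Preadditive.rightComp Y (End.asHom (α (MulAut.conjNormal x⁻¹ h)))).toIntLinearMap : Submodule ℤ (Y ⟶ Y)) := by
  set W₁ := (⨅ h : stabilizer G t₀,
    LinearMap.eqLocus (Preadditive.leftComp Y (End.asHom (α h))).toIntLinearMap
      (Preadditive.rightComp Y (b.ι (x • t₀) ≫ End.asHom (ρ h) ≫ b.π (x • t₀))).toIntLinearMap : Submodule ℤ (Y ⟶ Y))
    with hW₁
  set W₂ := (⨅ h : stabilizer G t₀,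
    LinearMap.eqLocus (Preadditive.leftComp Y (End.asHom (α h))).toIntLinearMap
      (Preadditive.rightComp Y (End.asHom (α (MulAut.conjNormal x⁻¹ h)))).toIntLinearMap : Submodule ℤ (Y ⟶ Y)) with hW₂
  have mem₁ : ∀ v : Y ⟶ Y, v ∈ W₁ ↔
      ∀ h : stabilizer G t₀, End.asHom (α h) ≫ v = v ≫ (b.ι (x • t₀) ≫ End.asHom (ρ h) ≫ b.π (x • t₀)) := fun v ↦ by
    rw [hW₁]
    simp only [Submodule.mem_iInf, LinearMap.mem_eqLocus]
    exact Iff.rfl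
  have mem₂ : ∀ w : Y ⟶ Y, w ∈ W₂ ↔
      ∀ h : stabilizer G t₀, End.asHom (α h) ≫ w = w ≫ End.asHom (α (MulAut.conjNormal x⁻¹ h)) := fun w ↦ by
    rw [hW₂]
    simp only [Submodule.mem_iInf, LinearMap.mem_eqLocus]
    exact Iff.rfl
  -- the transfer isomorphism `φ = φ_{x,t₀} : Y_{t₀} ≅ Y_{xt₀}` and its inverse
  have hφφ' := transfer_comp_transfer_inv b ρ hb hρ x t₀
  have hφ'φ := transfer_inv_comp_transfer b ρ hb hρ x t₀
  -- `α(k) ≫ φ = φ ≫ blk(h)` and `blk(h) ≫ φ⁻¹ = φ⁻¹ ≫ α(k)` for `k = x⁻¹hx`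
  have hk : ∀ h : stabilizer G t₀, x * (MulAut.conjNormal x⁻¹ h : G) * x⁻¹ = h := fun h ↦ by
    rw [MulAut.conjNormal_apply, inv_inv]; group
  have B2 : ∀ h : stabilizer G t₀, End.asHom (α (MulAut.conjNormal x⁻¹ h)) ≫ (b.ι t₀ ≫ End.asHom (ρ x) ≫ b.π (x • t₀)) =
      (b.ι t₀ ≫ End.asHom (ρ x) ≫ b.π (x • t₀)) ≫ (b.ι (x • t₀) ≫ End.asHom (ρ h) ≫ b.π (x • t₀)) := fun h ↦ by
    have e := asHom_stabilizerAction_comp_transfer_eq b ρ t₀ α hb hρ hα x (MulAut.conjNormal x⁻¹ h)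
    rw [hk h] at e
    exact e
  have B1 : ∀ h : stabilizer G t₀, (b.ι (x • t₀) ≫ End.asHom (ρ h) ≫ b.π (x • t₀)) ≫ (b.ι (x • t₀) ≫ End.asHom (ρ x⁻¹) ≫ b.π t₀) =
      (b.ι (x • t₀) ≫ End.asHom (ρ x⁻¹) ≫ b.π t₀) ≫ End.asHom (α (MulAut.conjNormal x⁻¹ h)) := fun h ↦ by
    have e := B2 h
    calc (b.ι (x • t₀) ≫ End.asHom (ρ h) ≫ b.π (x • t₀)) ≫ (b.ι (x • t₀) ≫ End.asHom (ρ x⁻¹) ≫ b.π t₀)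
        = ((b.ι (x • t₀) ≫ End.asHom (ρ x⁻¹) ≫ b.π t₀) ≫ (b.ι t₀ ≫ End.asHom (ρ x) ≫ b.π (x • t₀))) ≫
            (b.ι (x • t₀) ≫ End.asHom (ρ h) ≫ b.π (x • t₀)) ≫ (b.ι (x • t₀) ≫ End.asHom (ρ x⁻¹) ≫ b.π t₀) := by
          rw [hφ'φ, Category.id_comp]
      _ = (b.ι (x • t₀) ≫ End.asHom (ρ x⁻¹) ≫ b.π t₀) ≫
            ((b.ι t₀ ≫ End.asHom (ρ x) ≫ b.π (x • t₀)) ≫ (b.ι (x • t₀) ≫ End.asHom (ρ h) ≫ b.π (x • t₀))) ≫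
              (b.ι (x • t₀) ≫ End.asHom (ρ x⁻¹) ≫ b.π t₀) := by
          simp only [Category.assoc]
      _ = (b.ι (x • t₀) ≫ End.asHom (ρ x⁻¹) ≫ b.π t₀) ≫
            (End.asHom (α (MulAut.conjNormal x⁻¹ h)) ≫ (b.ι t₀ ≫ End.asHom (ρ x) ≫ b.π (x • t₀))) ≫
              (b.ι (x • t₀) ≫ End.asHom (ρ x⁻¹) ≫ b.π t₀) := by
          rw [← e]
      _ = (b.ι (x • t₀) ≫ End.asHom (ρ x⁻¹) ≫ b.π t₀) ≫ End.asHom (α (MulAut.conjNormal x⁻¹ h)) ≫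
            ((b.ι t₀ ≫ End.asHom (ρ x) ≫ b.π (x • t₀)) ≫ (b.ι (x • t₀) ≫ End.asHom (ρ x⁻¹) ≫ b.π t₀)) := by
          simp only [Category.assoc]
      _ = (b.ι (x • t₀) ≫ End.asHom (ρ x⁻¹) ≫ b.π t₀) ≫ End.asHom (α (MulAut.conjNormal x⁻¹ h)) := by
          rw [hφφ']
          simp only [Category.comp_id]
  let e : W₁ ≃+ W₂ :=
    { toFun := fun v ↦ ⟨(v : Y ⟶ Y) ≫ (b.ι (x • t₀) ≫ End.asHom (ρ x⁻¹) ≫ b.π t₀), (mem₂ _).2 fun h ↦ by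
          rw [← Category.assoc, (mem₁ _).1 v.2 h, Category.assoc, B1 h]
          simp only [Category.assoc]⟩
      invFun := fun w ↦ ⟨(w : Y ⟶ Y) ≫ (b.ι t₀ ≫ End.asHom (ρ x) ≫ b.π (x • t₀)), (mem₁ _).2 fun h ↦ by
          rw [← Category.assoc, (mem₂ _).1 w.2 h, Category.assoc, B2 h]
          simp only [Category.assoc]⟩
      left_inv := fun v ↦ Subtype.ext (by
          change ((v : Y ⟶ Y) ≫ _) ≫ _ = (v : Y ⟶ Y)
          rw [Category.assoc, hφ'φ]
          exact Category.comp_id _)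
      right_inv := fun w ↦ Subtype.ext (by
          change ((w : Y ⟶ Y) ≫ _) ≫ _ = (w : Y ⟶ Y)
          rw [Category.assoc, hφφ']
          exact Category.comp_id _)
      map_add' := fun v v' ↦ Subtype.ext (by
          change ((v : Y ⟶ Y) + (v' : Y ⟶ Y)) ≫ _ = (v : Y ⟶ Y) ≫ _ + (v' : Y ⟶ Y) ≫ _
          rw [Preadditive.add_comp]) }
  exact e.toIntLinearEquiv.finrank_eq

variable [Fintype G]

omit [Fintype T] in
/-- `Σ_{x ∈ G} F(x t₀) = |Stab(t₀)| · Σ_{t ∈ T} F(t)` for a transitive action (private helper). [folklore] -/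
private theorem sum_apply_smul_eq_card_stabilizer_smul'' [Fintype T] {M : Type*} [AddCommMonoid M] (F : T → M) :
    ∑ x : G, F (x • t₀) = Nat.card (stabilizer G t₀) • ∑ t : T, F t := by
  classical
  have hfib : ∀ t : T, (Finset.univ.filter fun x : G ↦ x • t₀ = t).card = Nat.card (stabilizer G t₀) := by
    intro t
    obtain ⟨x₀, hx₀⟩ := exists_smul_eq G t₀ t
    have e : {x : G // x • t₀ = t} ≃ stabilizer G t₀ :=
      { toFun := fun x ↦ ⟨x₀⁻¹ * x.1, by rw [mem_stabilizer_iff, mul_smul, x.2, ← hx₀, inv_smul_smul]⟩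
        invFun := fun h ↦ ⟨x₀ * (h : G), by rw [mul_smul, mem_stabilizer_iff.mp h.2, hx₀]⟩
        left_inv := fun x ↦ Subtype.ext (mul_inv_cancel_left x₀ x.1)
        right_inv := fun h ↦ Subtype.ext (inv_mul_cancel_left x₀ (h : G)) }
    rw [← Nat.card_congr e, Nat.card_eq_fintype_card, Fintype.card_subtype]
  rw [← Finset.sum_fiberwise Finset.univ (fun x : G ↦ x • t₀) (fun x ↦ F (x • t₀)), Finset.smul_sum]
  refine Finset.sum_congr rfl fun t _ ↦ ?_
  rw [Finset.sum_congr rfl (fun x hx ↦ by rw [(Finset.mem_filter.mp hx).2] :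
      ∀ x ∈ Finset.univ.filter (fun x : G ↦ x • t₀ = t), F (x • t₀) = F t), Finset.sum_const, hfib t]

/-- **Serre's Corollary to Prop. 23, integral form: `|H| · rk_ℤ End_G(Ind_H^G Y) = Σ_{x ∈ G} rk_ℤ Hom_H(α, α^x)`** for
`H = Stab(t₀)` NORMAL in a finite `G` (`α^x(h) = α(x⁻¹hx)`; any field): `⟨V, V⟩_G = Σ_{s ∈ G/H} ⟨ρ, ρ^s⟩_H` on the ranks of
equivariant endomorphism groups of abelian varieties — each coset `xH` contributes `rk Hom_H(α, α^x)`, so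
`rk End_G(Ind_H^G Y) = rk End_H(Y, α)` iff `α` and `α^x` are disjoint (`Hom_H(α, α^x) = 0`) for every `x ∉ H`
(Mackey's criterion, normal case: "`Ind ρ` is irreducible iff `ρ` is irreducible and not isomorphic to any conjugate `ρ^s`, `s ∉ H`").
[cite: SerreLinearRepresentations1977, §7.4 Prop. 23 and Cor.] [cite: MumfordAV1970, §19 Thm. 3 (p. 176)] -/
theorem card_stabilizer_mul_finrank_equivariantEnd_eq_sum_of_normal [(stabilizer G t₀).Normal]
    (hb : ∑ t, b.π t ≫ b.ι t = 𝟙 b.pt)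
    (hρ : ∀ (g : G) (t u : T), g • t ≠ u → b.ι t ≫ End.asHom (ρ g) ≫ b.π u = 0)
    (hα : ∀ h : stabilizer G t₀, End.asHom (α h) = b.ι t₀ ≫ End.asHom (ρ h) ≫ b.π t₀) :
    Nat.card (stabilizer G t₀) *
        Module.finrank ℤ (⨅ g : G, LinearMap.eqLocus (Preadditive.leftComp b.pt (End.asHom (ρ g))).toIntLinearMap
          (Preadditive.rightComp b.pt (End.asHom (ρ g))).toIntLinearMap : Submodule ℤ (b.pt ⟶ b.pt)) =
      ∑ x : G, Module.finrank ℤ (⨅ h : stabilizer G t₀,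
        LinearMap.eqLocus (Preadditive.leftComp Y (End.asHom (α h))).toIntLinearMap
          (Preadditive.rightComp Y (End.asHom (α (MulAut.conjNormal x⁻¹ h)))).toIntLinearMap : Submodule ℤ (Y ⟶ Y)) := by
  rw [finrank_equivariantEnd_eq_sum_of_normal b ρ t₀ α hb hρ hα, ← smul_eq_mul,
    ← sum_apply_smul_eq_card_stabilizer_smul'' t₀ (fun u ↦ Module.finrank ℤ (⨅ h : stabilizer G t₀,
      LinearMap.eqLocus (Preadditive.leftComp Y (End.asHom (α h))).toIntLinearMap
        (Preadditive.rightComp Y (b.ι u ≫ End.asHom (ρ h) ≫ b.π u)).toIntLinearMap : Submodule ℤ (Y ⟶ Y)))]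
  exact Finset.sum_congr rfl fun x _ ↦ finrank_equivariantHom_block_eq_finrank_conj b ρ t₀ α hb hρ hα x

/-! ## §3 The cosets of `H` itself contribute `rk_ℤ End_H(Y, α)` each: Mackey's criterion, normal case -/

omit [Fintype T] [IsPretransitive G T] [Fintype G] in
/-- **For `x ∈ H` the conjugate `α^x` is isomorphic to `α` (via `α(x)`), so `rk_ℤ Hom_H(α, α^x) = rk_ℤ End_H(Y, α)`**:
`w ↦ w ≫ α(x)` and `v ↦ v ≫ α(x)⁻¹` are inverse bijections `Hom_H(α, α^x) ≅ End_H(α)` ("for `s ∈ H`, `ρ^s ≅ ρ`").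
[cite: SerreLinearRepresentations1977, §7.4 (proof of the Corollary)] -/
theorem finrank_equivariantHom_conj_eq_of_mem [(stabilizer G t₀).Normal] (x : G) (hx : x ∈ stabilizer G t₀) :
    Module.finrank ℤ (⨅ h : stabilizer G t₀,
        LinearMap.eqLocus (Preadditive.leftComp Y (End.asHom (α h))).toIntLinearMap
          (Preadditive.rightComp Y (End.asHom (α (MulAut.conjNormal x⁻¹ h)))).toIntLinearMap : Submodule ℤ (Y ⟶ Y)) =
      Module.finrank ℤ (⨅ h : stabilizer G t₀,
        LinearMap.eqLocus (Preadditive.leftComp Y (End.asHom (α h))).toIntLinearMap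
          (Preadditive.rightComp Y (End.asHom (α h))).toIntLinearMap : Submodule ℤ (Y ⟶ Y)) := by
  set x' : stabilizer G t₀ := ⟨x, hx⟩ with hx'
  set W₂ := (⨅ h : stabilizer G t₀,
    LinearMap.eqLocus (Preadditive.leftComp Y (End.asHom (α h))).toIntLinearMap
      (Preadditive.rightComp Y (End.asHom (α (MulAut.conjNormal x⁻¹ h)))).toIntLinearMap : Submodule ℤ (Y ⟶ Y)) with hW₂
  set E := (⨅ h : stabilizer G t₀,
    LinearMap.eqLocus (Preadditive.leftComp Y (End.asHom (α h))).toIntLinearMap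
      (Preadditive.rightComp Y (End.asHom (α h))).toIntLinearMap : Submodule ℤ (Y ⟶ Y)) with hE
  have mem₂ : ∀ w : Y ⟶ Y, w ∈ W₂ ↔
      ∀ h : stabilizer G t₀, End.asHom (α h) ≫ w = w ≫ End.asHom (α (MulAut.conjNormal x⁻¹ h)) := fun w ↦ by
    rw [hW₂]
    simp only [Submodule.mem_iInf, LinearMap.mem_eqLocus]
    exact Iff.rfl
  have memE : ∀ v : Y ⟶ Y, v ∈ E ↔ ∀ h : stabilizer G t₀, End.asHom (α h) ≫ v = v ≫ End.asHom (α h) := fun v ↦ by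
    rw [hE]
    simp only [Submodule.mem_iInf, LinearMap.mem_eqLocus]
    exact Iff.rfl
  -- `α^x(h) = α(x'⁻¹ h x')`, i.e. `asHom α^x(h) = α(x') ≫ α(h) ≫ α(x')⁻¹` as morphisms
  have hconj : ∀ h : stabilizer G t₀, End.asHom (α (MulAut.conjNormal x⁻¹ h)) =
      End.asHom (α x') ≫ End.asHom (α h) ≫ End.asHom (α x'⁻¹) := fun h ↦ by
    rw [← asHom_map_mul_eq_comp, ← asHom_map_mul_eq_comp]
    congr 2
    ext
    rw [MulAut.conjNormal_apply, inv_inv, Subgroup.coe_mul, Subgroup.coe_mul, Subgroup.coe_inv]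
  let e : W₂ ≃+ E :=
    { toFun := fun w ↦ ⟨(w : Y ⟶ Y) ≫ End.asHom (α x'), (memE _).2 fun h ↦ by
          rw [← Category.assoc, (mem₂ _).1 w.2 h, hconj h]
          simp only [Category.assoc]
          rw [asHom_inv_comp_asHom, Category.comp_id]⟩
      invFun := fun v ↦ ⟨(v : Y ⟶ Y) ≫ End.asHom (α x'⁻¹), (mem₂ _).2 fun h ↦ by
          rw [← Category.assoc, (memE _).1 v.2 h, hconj h]
          simp only [Category.assoc]
          rw [← Category.assoc (End.asHom (α x'⁻¹)) (End.asHom (α x')), asHom_inv_comp_asHom, Category.id_comp]⟩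
      left_inv := fun w ↦ Subtype.ext (by
          change ((w : Y ⟶ Y) ≫ _) ≫ _ = (w : Y ⟶ Y)
          rw [Category.assoc, asHom_comp_asHom_inv, Category.comp_id])
      right_inv := fun v ↦ Subtype.ext (by
          change ((v : Y ⟶ Y) ≫ _) ≫ _ = (v : Y ⟶ Y)
          rw [Category.assoc, asHom_inv_comp_asHom, Category.comp_id])
      map_add' := fun w w' ↦ Subtype.ext (by
          change ((w : Y ⟶ Y) + (w' : Y ⟶ Y)) ≫ _ = (w : Y ⟶ Y) ≫ _ + (w' : Y ⟶ Y) ≫ _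
          rw [Preadditive.add_comp]) }
  exact e.toIntLinearEquiv.finrank_eq

/-- **Mackey's criterion, normal case, for abelian varieties:
`|H| · rk_ℤ End_G(Ind_H^G Y) = |H| · rk_ℤ End_H(Y, α) + Σ_{x ∉ H} rk_ℤ Hom_H(α, α^x)`** (`H = Stab(t₀)` normal, `G`
finite, any field): the `|H|` elements of `H` contribute `rk End_H(α)` each (§3), the others `rk Hom_H(α, α^x)`; hence
`rk End_G(Ind_H^G Y) ≥ rk End_H(Y, α)`, with equality iff `Hom_H(α, α^x) = 0` for all `x ∉ H` ("`Ind ρ` is irreducible iff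
`ρ` is irreducible and `ρ^s ≇ ρ` for every `s ∉ H`"). [cite: SerreLinearRepresentations1977, §7.4 Prop. 23 and Cor.]
[cite: MumfordAV1970, §19 Thm. 3 (p. 176)] -/
theorem card_stabilizer_mul_finrank_equivariantEnd_eq_add_sum_of_normal [(stabilizer G t₀).Normal]
    [DecidablePred (· ∈ stabilizer G t₀)] (hb : ∑ t, b.π t ≫ b.ι t = 𝟙 b.pt)
    (hρ : ∀ (g : G) (t u : T), g • t ≠ u → b.ι t ≫ End.asHom (ρ g) ≫ b.π u = 0)
    (hα : ∀ h : stabilizer G t₀, End.asHom (α h) = b.ι t₀ ≫ End.asHom (ρ h) ≫ b.π t₀) :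
    Nat.card (stabilizer G t₀) *
        Module.finrank ℤ (⨅ g : G, LinearMap.eqLocus (Preadditive.leftComp b.pt (End.asHom (ρ g))).toIntLinearMap
          (Preadditive.rightComp b.pt (End.asHom (ρ g))).toIntLinearMap : Submodule ℤ (b.pt ⟶ b.pt)) =
      Nat.card (stabilizer G t₀) *
          Module.finrank ℤ (⨅ h : stabilizer G t₀,
            LinearMap.eqLocus (Preadditive.leftComp Y (End.asHom (α h))).toIntLinearMap
              (Preadditive.rightComp Y (End.asHom (α h))).toIntLinearMap : Submodule ℤ (Y ⟶ Y)) +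
        ∑ x ∈ Finset.univ.filter (fun x : G ↦ x ∉ stabilizer G t₀), Module.finrank ℤ (⨅ h : stabilizer G t₀,
          LinearMap.eqLocus (Preadditive.leftComp Y (End.asHom (α h))).toIntLinearMap
            (Preadditive.rightComp Y (End.asHom (α (MulAut.conjNormal x⁻¹ h)))).toIntLinearMap : Submodule ℤ (Y ⟶ Y)) := by
  rw [card_stabilizer_mul_finrank_equivariantEnd_eq_sum_of_normal b ρ t₀ α hb hρ hα,
    ← Finset.sum_filter_add_sum_filter_not Finset.univ (fun x : G ↦ x ∈ stabilizer G t₀)]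
  congr 1
  rw [Finset.sum_congr rfl fun x hx ↦ finrank_equivariantHom_conj_eq_of_mem t₀ α x (Finset.mem_filter.1 hx).2,
    Finset.sum_const, smul_eq_mul]
  congr 1
  rw [← Fintype.card_subtype, Nat.card_eq_fintype_card]

/-- **`rk_ℤ End_H(Y, α) ≤ rk_ℤ End_G(Ind_H^G Y)` for `H` normal**, with equality iff every `Hom_H(α, α^x)`, `x ∉ H`, has rank
`0`. [cite: SerreLinearRepresentations1977, §7.4 Cor.] -/
theorem finrank_equivariantEnd_stabilizer_le_of_normal [(stabilizer G t₀).Normal] (hb : ∑ t, b.π t ≫ b.ι t = 𝟙 b.pt)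
    (hρ : ∀ (g : G) (t u : T), g • t ≠ u → b.ι t ≫ End.asHom (ρ g) ≫ b.π u = 0)
    (hα : ∀ h : stabilizer G t₀, End.asHom (α h) = b.ι t₀ ≫ End.asHom (ρ h) ≫ b.π t₀) :
    Module.finrank ℤ (⨅ h : stabilizer G t₀,
        LinearMap.eqLocus (Preadditive.leftComp Y (End.asHom (α h))).toIntLinearMap
          (Preadditive.rightComp Y (End.asHom (α h))).toIntLinearMap : Submodule ℤ (Y ⟶ Y)) ≤
      Module.finrank ℤ (⨅ g : G, LinearMap.eqLocus (Preadditive.leftComp b.pt (End.asHom (ρ g))).toIntLinearMap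
        (Preadditive.rightComp b.pt (End.asHom (ρ g))).toIntLinearMap : Submodule ℤ (b.pt ⟶ b.pt)) := by
  classical
  haveI : Fintype (stabilizer G t₀) := Fintype.ofFinite _
  refine Nat.le_of_mul_le_mul_left ?_ (Nat.card_pos (α := stabilizer G t₀))
  rw [card_stabilizer_mul_finrank_equivariantEnd_eq_add_sum_of_normal b ρ t₀ α hb hρ hα]
  exact Nat.le_add_right _ _

end Normal

end Imprimitive

end AbelianVariety

end Literature.AlgebraicGeometry.Motives
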